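import Mathlib
import Summits.AtomisticToContinuum.Crystallization.Theorems.ChessboardParticlePlanesLjLaminarWindowsMassBoundA
import HarnessLib

/-! # All-spiky neighbourhoods are impossible in the sparse regime, part A — counting helpers of stub
`stub_sparseAllSpiky` of line `Sketch` (skeleton rev. 14a, lead c8), crux `LjLaminarWindows`
(stmt-AtomisticToContinuum-6711)

Abstract counting lemmas for Stage B of the non-spiky-fraction argument: a pigeonhole for triangular
double sums (`sparse_exists_big_term`), Bonferroni re-indexed over a finite set of labels with the
extraction of two distinct labels whose sets meet in many points (`sparse_two_labels`), and the choice
of a third index among two distinct pairs (`sparse_third_index`). -/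

noncomputable section

open scoped BigOperators
open Filter Topology
open Literature.MathematicalPhysics.StatisticalMechanics
open Summit.AtomisticToContinuum.Crystallization.Theorems.ChargedEnergyGapNegative

namespace Summit.AtomisticToContinuum.Crystallization.Theorems.LjLaminarWindowsSketch

/-- Pigeonhole for a triangular double sum: if `0 < Λ ≤ ∑_{k<P} ∑_{k'<k} f k k'` then some term with
`k' < k < P` is at least `Λ / P²`. [folklore] -/
theorem sparse_exists_big_term (f : ℕ → ℕ → ℝ) (P : ℕ) {Λ : ℝ} (hΛ : 0 < Λ)
    (hsum : Λ ≤ ∑ k ∈ Finset.range P, ∑ k' ∈ Finset.range k, f k k') :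
    ∃ k < P, ∃ k' < k, Λ / (P : ℝ) ^ 2 ≤ f k k' := by
  by_contra hcon
  push Not at hcon
  rcases Nat.eq_zero_or_pos P with hP | hP
  · subst hP
    simp at hsum
    linarith
  have hPpos : (0 : ℝ) < P := by exact_mod_cast hP
  have hinner : ∀ k ∈ Finset.range P, ∑ k' ∈ Finset.range k, f k k' ≤ (k : ℝ) * (Λ / (P : ℝ) ^ 2) := by
    intro k hk
    have hk' := Finset.mem_range.1 hk
    calc ∑ k' ∈ Finset.range k, f k k' ≤ ∑ _k' ∈ Finset.range k, Λ / (P : ℝ) ^ 2 :=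
          Finset.sum_le_sum fun k' hk'' => (hcon k hk' k' (Finset.mem_range.1 hk'')).le
      _ = (k : ℝ) * (Λ / (P : ℝ) ^ 2) := by rw [Finset.sum_const, Finset.card_range, nsmul_eq_mul]
  have htot : ∑ k ∈ Finset.range P, ∑ k' ∈ Finset.range k, f k k' ≤
      ∑ k ∈ Finset.range P, (k : ℝ) * (Λ / (P : ℝ) ^ 2) := Finset.sum_le_sum hinner
  have hk : ∀ k ∈ Finset.range P, (k : ℝ) * (Λ / (P : ℝ) ^ 2) ≤ ((P : ℝ) - 1) * (Λ / (P : ℝ) ^ 2) := by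
    intro k hk
    have hk' : (k : ℝ) + 1 ≤ P := by exact_mod_cast Finset.mem_range.1 hk
    exact mul_le_mul_of_nonneg_right (by linarith) (by positivity)
  have htot2 : ∑ k ∈ Finset.range P, (k : ℝ) * (Λ / (P : ℝ) ^ 2) ≤
      (P : ℝ) * (((P : ℝ) - 1) * (Λ / (P : ℝ) ^ 2)) := by
    have h := Finset.sum_le_sum hk
    rw [Finset.sum_const, Finset.card_range, nsmul_eq_mul] at h
    exact h
  have hlt : (P : ℝ) * (((P : ℝ) - 1) * (Λ / (P : ℝ) ^ 2)) < Λ := by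
    have e : (P : ℝ) * (((P : ℝ) - 1) * (Λ / (P : ℝ) ^ 2)) = Λ - Λ / P := by
      field_simp
    rw [e]
    have : 0 < Λ / P := div_pos hΛ hPpos
    linarith
  linarith

/-- **Two labels whose sets meet in many points.** Bonferroni re-indexed over a finite set `s` of
labels: if all `A p ⊆ U` and `∑_{p ∈ s} #A p ≥ #U + Λ` with `Λ > 0`, then two DISTINCT labels
`p ≠ p'` of `s` have `#(A p ∩ A p') ≥ Λ / (#s)²`. [folklore] -/
theorem sparse_two_labels {N : ℕ} {ι : Type*} [DecidableEq ι]
    (hBonf : ∀ (N' n : ℕ) (A : ℕ → Finset (Fin N')),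
      ∑ i ∈ Finset.range n, ((A i).card : ℝ) ≤
        (((Finset.range n).biUnion A).card : ℝ) +
          ∑ i ∈ Finset.range n, ∑ j ∈ Finset.range i, ((A i ∩ A j).card : ℝ))
    (s : Finset ι) (A : ι → Finset (Fin N)) (U : Finset (Fin N)) {Λ : ℝ} (hΛ : 0 < Λ)
    (hU : ∀ p ∈ s, A p ⊆ U) (hsum : (U.card : ℝ) + Λ ≤ ∑ p ∈ s, ((A p).card : ℝ)) :
    ∃ p ∈ s, ∃ p' ∈ s, p ≠ p' ∧ Λ / (s.card : ℝ) ^ 2 ≤ ((A p ∩ A p').card : ℝ) := by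
  classical
  set e := s.equivFin with he
  -- re-indexed family
  set A' : ℕ → Finset (Fin N) := fun k => if h : k < s.card then A (e.symm ⟨k, h⟩) else ∅ with hA'
  have hA'lt : ∀ k (hk : k < s.card), A' k = A (e.symm ⟨k, hk⟩) := fun k hk => by
    simp only [hA', dif_pos hk]
  have hB := hBonf N s.card A'
  -- the left sum is the sum over `s`
  have hleft : ∑ k ∈ Finset.range s.card, ((A' k).card : ℝ) = ∑ p ∈ s, ((A p).card : ℝ) := by
    rw [← Fin.sum_univ_eq_sum_range (fun k => ((A' k).card : ℝ))]
    have e1 : ∑ k : Fin s.card, ((A' k).card : ℝ) = ∑ k : Fin s.card, ((A (e.symm k)).card : ℝ) :=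
      Finset.sum_congr rfl fun k _ => by rw [hA'lt k k.2]
    rw [e1, Equiv.sum_comp e.symm (fun p => ((A p).card : ℝ)), ← Finset.sum_coe_sort s]
  -- the union lies in `U`
  have hunion : (((Finset.range s.card).biUnion A').card : ℝ) ≤ U.card := by
    have hsub : (Finset.range s.card).biUnion A' ⊆ U := by
      refine Finset.biUnion_subset.2 fun k hk => ?_
      have hk' := Finset.mem_range.1 hk
      rw [hA'lt k hk']
      exact hU _ (e.symm ⟨k, hk'⟩).2
    exact_mod_cast Finset.card_le_card hsub
  have hdouble : Λ ≤ ∑ k ∈ Finset.range s.card, ∑ k' ∈ Finset.range k, ((A' k ∩ A' k').card : ℝ) := by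
    linarith
  obtain ⟨k, hk, k', hk', hbig⟩ :=
    sparse_exists_big_term (fun k k' => ((A' k ∩ A' k').card : ℝ)) s.card hΛ hdouble
  have hk's : k' < s.card := hk'.trans hk
  refine ⟨(e.symm ⟨k, hk⟩).1, (e.symm ⟨k, hk⟩).2, (e.symm ⟨k', hk's⟩).1, (e.symm ⟨k', hk's⟩).2, ?_, ?_⟩
  · intro heq
    have h1 : e.symm ⟨k, hk⟩ = e.symm ⟨k', hk's⟩ := Subtype.ext heq
    have h2 := e.symm.injective h1
    simp only [Fin.mk.injEq] at h2
    omega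
  · have e2 : A' k ∩ A' k' = A (e.symm ⟨k, hk⟩).1 ∩ A (e.symm ⟨k', hk's⟩).1 := by
      rw [hA'lt k hk, hA'lt k' hk's]
    rw [← e2]
    exact hbig

/-- Among two distinct strictly-ordered pairs `(i, j)`, `(i', j')` (`j < i`, `j' < i'`) one of
`i', j'` differs from both `i` and `j`. [folklore] -/
theorem sparse_third_index :
    ∀ {i j i' j' : ℕ}, j < i → j' < i' → (i, j) ≠ (i', j') →
      ∃ c : ℕ, (c = i' ∨ c = j') ∧ c ≠ i ∧ c ≠ j := by
  intro i j i' j' hij hij' hne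
  by_cases h1 : i' ≠ i ∧ i' ≠ j
  · exact ⟨i', Or.inl rfl, h1.1, h1.2⟩
  · by_cases h2 : j' ≠ i ∧ j' ≠ j
    · exact ⟨j', Or.inr rfl, h2.1, h2.2⟩
    · exfalso
      simp only [ne_eq, Prod.mk.injEq, not_and] at hne h1 h2
      omega

end Summit.AtomisticToContinuum.Crystallization.Theorems.LjLaminarWindowsSketch

end
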